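import Mathlib
import HarnessLib
import Summits.HubbardSuperconductivity.HubbardSuperconductivity.Theorems.KLProgrammeC4aEnvelopeLevelLayers

/-!
# Route `KLProgramme` — crux C4a, S3 brick (B4)/(B5) «(B4)-ABS-BUBBLE», part 4: ASSEMBLED — the absolute bubble's LEVEL × LOOP integral
# `∫ de w(e) ∫ dφ/max(t_e, |ē(e,φ)|)` is `n`-free in each configuration class (transversal / fold / Cooper), and the Cooper window's tube-angle layer

Cell `gate-hubbard-kl`, seat hubbard-kl-k3c3-p3 (g26; row «implicit-function / monotonicity route for μ(n)»).  Located brick for the (C)-closer lane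
hubbard-kl-c4a-1 (stub (C) `stub_twoLeg_curvature` of `KLRegimeEngineV17F2`, stmt-HubbardSuperconductivity-20437), C4A-PLAN §24.4–§24.6 (B4)/(B5),
HOME/hubbard-kl-k3c3-p3/B4-DIRECT-COUNT.md §2 and B4-ABS-BUBBLE.md §1 (S5).  Capstone of `…C4aSublevelCounting` → `…C4aEnvelopeLayerCake` →
`…C4aEnvelopeLevelLayers`: the loop-angle lemma of the class composed with the level layer, for a LEVEL FAMILY `G e = ē(e,·;ρ,ϑ,θ)` of loop profiles on
`[a,b]` (`e ∈ [lo,hi]`, `0 < lo` = the band window's infrared end, `hi = E₀`), envelope floors `t e ≥ e` (the finer-line split), weight `0 ≤ w ≤ W` (Jacobian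
tables × cutoffs × frequency factor):

* **`level_loop_inv_envelope_le_of_dichotomy_one`** (TRANSVERSAL class — generic direct configurations, transversal umklapp crossings): a uniform first-order
  dichotomy `|G e x| ≤ κ → c₁ ≤ |∂ₓG e x|` (ceiling `L₁`, `N` cells) ⟹ `≤ W·(2(b−a)/κ + (2N/c₁)(1 + log⁺(κ/(2hi))))·(hi − lo)`.
* **`level_loop_inv_envelope_le_of_dichotomy_two`** (FOLD class — tangency window (T), umklapp caustics (T_G)): a uniform second-order dichotomy
  `|G| ≤ κ → |∂ₓG| < c₁ → c₂ ≤ |∂ₓ²G|` ⟹ `≤ W·((2(b−a)/κ + (4N/c₁)(1 + log⁺(κ/(2hi))))·(hi − lo) + 2·(12N/√c₂)·√hi)`.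
* **`level_loop_inv_envelope_le_cooper`** (COOPER class at base scale `η = ‖ϑ − π‖_𝕋 > 0`): the scaled dichotomy `|G e x − e| ≤ ĉ₀η → ĉ₁η ≤ |∂ₓG e x|`,
  ceiling `L̂₁η`, `(b − a)·4L̂₁ ≤ N·ĉ₀` ⟹ `≤ W·(2(b − a) + 2Nĉ₀/ĉ₁ + (b − a)·log⁺(hi/(ĉ₀η/2)))` — ONE logarithm of `η`, integrable over the Cooper window
  (`intervalIntegral_posLog_div_le`).
* **`intervalIntegral_cooper_window_le`** (§7, the TUBE-ANGLE layer of the Cooper class): `0 ≤ F ϑ ≤ K + P·log⁺(M/|ϑ − c|)` off the centre of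
  `[c − δ, c + δ]` ⟹ `∫_{c−δ..c+δ} F ≤ 2δ·(K + P·(1 + log⁺(M/δ)))` — the Cooper logarithm is integrable in `ϑ`.
All right-hand sides are free of `lo`: **`sup_{ρ,θ} ∫dϑ |𝐁|_abs` is `n`-free** given uniform dichotomy constants per class (memo §3 lists the rows).
No integrability hypotheses (non-integrable integrands have integral `0` by convention).  Carrier-free; nothing about the Hubbard model's sizes; nothing
asserts (C), K3 or superconductivity.  References: Salmhofer, Renormalization (1999) §4.5.3 Lemma 4.10 / Cor. 4.11, §4.6.2 [cite: Salmhofer1999]; FST II,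
CPAM 51 (1998) §3 [cite: FeldmanSalmhoferTrubowitz1998]; BGM 2006 §2.4, App. A2 [cite: BenfattoGiulianiMastropietro2006].
-/

noncomputable section

namespace Summit.HubbardSuperconductivity.HubbardSuperconductivity.Theorems.C4a

set_option linter.dupNamespace false -- summit = problem name (single-conjunct summit), D-0017

open Real Set Filter MeasureTheory intervalIntegral
open scoped Topology ENNReal

/-! ## §6 ASSEMBLED: the absolute bubble's LEVEL × LOOP integral in the three configuration classes -/

section Assembled

variable {a b lo hi : ℝ} {G : ℝ → ℝ → ℝ} {t w : ℝ → ℝ}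

/-- The loop-angle envelope integral is nonnegative. -/
theorem integral_inv_envelope_nonneg (g : ℝ → ℝ) {τ : ℝ} (hτ : 0 < τ) (a b : ℝ) : 0 ≤ ∫ x in Icc a b, (max τ |g x|)⁻¹ :=
  integral_nonneg fun x => inv_envelope_nonneg g hτ x

/-- `log⁺(κ/(2τ)) ≤ log⁺(κ/2/e)` for `0 < e ≤ τ` (`κ ≥ 0`): the envelope floor `t ≥ |e|` only helps. -/
theorem posLog_div_two_mul_le {κ e τ : ℝ} (hκ : 0 ≤ κ) (he : 0 < e) (heτ : e ≤ τ) : log⁺ (κ / (2 * τ)) ≤ log⁺ (κ / 2 / e) := by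
  have hτ : 0 < τ := he.trans_le heτ
  refine Real.posLog_le_posLog (by positivity) ?_
  rw [div_div]
  exact div_le_div_of_nonneg_left hκ (by positivity) (by linarith)

/-- **TRANSVERSAL CLASS, ASSEMBLED.**  A level family `G e = ē(e,·)` (`e ∈ [lo,hi]`, `0 < lo`) of `C¹` loop profiles with a UNIFORM first-order dichotomy
(`|G e x| ≤ κ → c₁ ≤ |∂ₓG e x|`, ceiling `L₁`, `N` cells), envelope floors `t e ≥ e` and a weight `0 ≤ w ≤ W` ⟹
`∫_{lo..hi} w(e)·(∫_{[a,b]} dx/max(t e, |G e x|)) de ≤ W·(2(b−a)/κ + (2N/c₁)(1 + log⁺(κ/(2hi))))·(hi − lo)` — independent of `lo`: the absolute bubble over a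
transversal configuration is `n`-free. [cite: Salmhofer1999, §4.5.3 Lemma 4.10; FeldmanSalmhoferTrubowitz1998, §3] -/
theorem level_loop_inv_envelope_le_of_dichotomy_one (hab : a ≤ b) (hlo : 0 < lo) (hlohi : lo ≤ hi) (hG : ∀ e ∈ Icc lo hi, ContDiff ℝ 1 (G e))
    {κ c₁ L₁ W : ℝ} {N : ℕ} (hκ : 0 < κ) (hc₁ : 0 < c₁) (hL₁ : 0 < L₁) (hL : ∀ e ∈ Icc lo hi, ∀ x ∈ Icc a b, |deriv (G e) x| ≤ L₁)
    (hdich : ∀ e ∈ Icc lo hi, ∀ x ∈ Icc a b, |G e x| ≤ κ → c₁ ≤ |deriv (G e) x|) (hN : (b - a) * (2 * L₁) ≤ N * κ)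
    (ht : ∀ e ∈ Icc lo hi, e ≤ t e) (hW : 0 ≤ W) (hw0 : ∀ e ∈ Icc lo hi, 0 ≤ w e) (hw : ∀ e ∈ Icc lo hi, w e ≤ W) :
    ∫ e in lo..hi, w e * ∫ x in Icc a b, (max (t e) |G e x|)⁻¹ ≤
      W * ((2 * (b - a) / κ + N * (2 / c₁) * (1 + log⁺ (κ / 2 / hi))) * (hi - lo)) := by
  have hte : ∀ e ∈ Icc lo hi, 0 < t e := fun e he => (hlo.trans_le he.1).trans_le (ht e he)
  have key := intervalIntegral_level_layer_le hlo hlohi (w := w) (I := fun e => ∫ x in Icc a b, (max (t e) |G e x|)⁻¹) (κ := κ / 2)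
    (A := 2 * (b - a) / κ) (B := N * (2 / c₁)) (C := 0) hW (div_nonneg (by linarith) hκ.le) (by positivity) le_rfl hw0 hw
    (fun e he => integral_inv_envelope_nonneg (G e) (hte e he) a b) fun e he => by
      have h := integral_inv_envelope_le_of_dichotomy_one hab (hG e he) hκ hc₁ hL₁ (hL e he) (hdich e he) hN (hte e he)
      have hlog := posLog_div_two_mul_le hκ.le (hlo.trans_le he.1) (ht e he)
      have hB : 0 ≤ (N : ℝ) * (2 / c₁) := by positivity
      rw [zero_mul, add_zero]
      exact h.trans (by nlinarith [mul_le_mul_of_nonneg_left hlog hB])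
  simpa using key

/-- **FOLD CLASS, ASSEMBLED** (tangency window, umklapp caustic).  As above with a UNIFORM second-order dichotomy (`|G e x| ≤ κ → |∂ₓG| < c₁ → c₂ ≤ |∂ₓ²G|`,
ceilings `L₁, L₂`) ⟹ `∫_{lo..hi} w(e)·(∫ dx/max(t e,|G e x|)) de ≤ W·((2(b−a)/κ + (4N/c₁)(1 + log⁺(κ/(2hi))))·(hi − lo) + 2·(12N/√c₂)·√hi)` — the fold's
`t^{−1/2}` integrates to `√hi`; `lo`-free. [cite: Salmhofer1999, §4.5.3 Lemma 4.10; FeldmanSalmhoferTrubowitz1998, §3] -/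
theorem level_loop_inv_envelope_le_of_dichotomy_two (hab : a ≤ b) (hlo : 0 < lo) (hlohi : lo ≤ hi) (hG : ∀ e ∈ Icc lo hi, ContDiff ℝ 2 (G e))
    {κ c₁ c₂ L₁ L₂ W : ℝ} {N : ℕ} (hκ : 0 < κ) (hc₁ : 0 < c₁) (hc₂ : 0 < c₂) (hL₁ : 0 < L₁) (hL₂ : 0 < L₂)
    (hL : ∀ e ∈ Icc lo hi, ∀ x ∈ Icc a b, |deriv (G e) x| ≤ L₁) (hL' : ∀ e ∈ Icc lo hi, ∀ x ∈ Icc a b, |iteratedDeriv 2 (G e) x| ≤ L₂)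
    (hdich : ∀ e ∈ Icc lo hi, ∀ x ∈ Icc a b, |G e x| ≤ κ → |deriv (G e) x| < c₁ → c₂ ≤ |iteratedDeriv 2 (G e) x|)
    (hN : (b - a) * (2 * L₁) ≤ N * κ) (hN' : (b - a) * (4 * L₂) ≤ N * c₁)
    (ht : ∀ e ∈ Icc lo hi, e ≤ t e) (hW : 0 ≤ W) (hw0 : ∀ e ∈ Icc lo hi, 0 ≤ w e) (hw : ∀ e ∈ Icc lo hi, w e ≤ W) :
    ∫ e in lo..hi, w e * ∫ x in Icc a b, (max (t e) |G e x|)⁻¹ ≤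
      W * ((2 * (b - a) / κ + N * (4 / c₁) * (1 + log⁺ (κ / 2 / hi))) * (hi - lo) + 2 * (12 * N / Real.sqrt c₂) * Real.sqrt hi) := by
  have hte : ∀ e ∈ Icc lo hi, 0 < t e := fun e he => (hlo.trans_le he.1).trans_le (ht e he)
  have hsc : 0 < Real.sqrt c₂ := Real.sqrt_pos.2 hc₂
  exact intervalIntegral_level_layer_le hlo hlohi (w := w) (I := fun e => ∫ x in Icc a b, (max (t e) |G e x|)⁻¹) (κ := κ / 2)
    (A := 2 * (b - a) / κ) (B := N * (4 / c₁)) (C := 12 * N / Real.sqrt c₂) hW (div_nonneg (by linarith) hκ.le) (by positivity) (by positivity)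
    hw0 hw (fun e he => integral_inv_envelope_nonneg (G e) (hte e he) a b) fun e he => by
      have he0 : 0 < e := hlo.trans_le he.1
      have h := integral_inv_envelope_le_of_dichotomy_two hab (hG e he) hκ hc₁ hc₂ hL₁ hL₂ (hL e he) (hL' e he) (hdich e he) hN hN' (hte e he)
      have hlog := posLog_div_two_mul_le hκ.le he0 (ht e he)
      have hB : 0 ≤ (N : ℝ) * (4 / c₁) := by positivity
      -- `12N/√(c₂ t) ≤ (12N/√c₂)·(√e)⁻¹`
      have hsq : 12 * N / Real.sqrt (c₂ * t e) ≤ 12 * N / Real.sqrt c₂ * (Real.sqrt e)⁻¹ := by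
        rw [Real.sqrt_mul hc₂.le, ← div_div, div_eq_mul_inv (12 * N / Real.sqrt c₂)]
        refine mul_le_mul_of_nonneg_left ?_ (by positivity)
        exact inv_anti₀ (Real.sqrt_pos.2 he0) (Real.sqrt_le_sqrt (ht e he))
      exact h.trans (by nlinarith [mul_le_mul_of_nonneg_left hlog hB])

/-- **COOPER CLASS, ASSEMBLED.**  A level family of `C¹` loop profiles with the SCALED first-order dichotomy at the base scale `η > 0`
(`|G e x − e| ≤ ĉ₀η → ĉ₁η ≤ |∂ₓG e x|`, ceiling `|∂ₓG| ≤ L̂₁η`, `N` cells with `(b − a)·4L̂₁ ≤ N·ĉ₀`), envelope floors `t e ≥ e`, weight `0 ≤ w ≤ W` ⟹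
`∫_{lo..hi} w(e)·(∫ dx/max(t e,|G e x|)) de ≤ W·(2(b − a) + 2Nĉ₀/ĉ₁ + (b − a)·log⁺(hi/(ĉ₀η/2)))` — `lo`-free and `η`-free but for ONE LOGARITHM of the
distance to the Cooper configuration (Salmhofer's Cor. 4.11 in co-moving coordinates). [cite: Salmhofer1999, §4.5.3 Cor. 4.11; FeldmanSalmhoferTrubowitz1998, §3] -/
theorem level_loop_inv_envelope_le_cooper (hab : a ≤ b) (hlo : 0 < lo) (hlohi : lo ≤ hi) (hG : ∀ e ∈ Icc lo hi, ContDiff ℝ 1 (G e))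
    {η c₀ c₁ L₁ W : ℝ} {N : ℕ} (hη : 0 < η) (hc₀ : 0 < c₀) (hc₁ : 0 < c₁) (hL₁ : 0 < L₁)
    (hL : ∀ e ∈ Icc lo hi, ∀ x ∈ Icc a b, |deriv (G e) x| ≤ L₁ * η)
    (hdich : ∀ e ∈ Icc lo hi, ∀ x ∈ Icc a b, |G e x - e| ≤ c₀ * η → c₁ * η ≤ |deriv (G e) x|) (hN : (b - a) * (4 * L₁) ≤ N * c₀)
    (ht : ∀ e ∈ Icc lo hi, e ≤ t e) (hW : 0 ≤ W) (hw0 : ∀ e ∈ Icc lo hi, 0 ≤ w e) (hw : ∀ e ∈ Icc lo hi, w e ≤ W) :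
    ∫ e in lo..hi, w e * ∫ x in Icc a b, (max (t e) |G e x|)⁻¹ ≤
      W * (2 * (b - a) + 2 * (N * c₀ / c₁) + (b - a) * log⁺ (hi / (c₀ * η / 2))) := by
  have hte : ∀ e ∈ Icc lo hi, 0 < t e := fun e he => (hlo.trans_le he.1).trans_le (ht e he)
  have hθ₀ : 0 < c₀ * η / 2 := by positivity
  have key := intervalIntegral_level_layer_cooper_le hlo hlohi (w := w) (I := fun e => ∫ x in Icc a b, (max (t e) |G e x|)⁻¹)
    (P := b - a) (Q := 4 * (b - a) / c₀ / η) (R := N * (2 / c₁) / η) hθ₀ hW (by linarith) (by positivity) (by positivity) hw0 hw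
    (fun e he => integral_inv_envelope_nonneg (G e) (hte e he) a b) ?_ ?_
  · refine key.trans (le_of_eq ?_)
    field_simp
    ring
  · -- small levels: the Cooper lemma, then `log⁺(ĉ₀η/(4t)) ≤ log⁺((ĉ₀η/2)/(2e))`
    intro e he heθ
    have he0 : 0 < e := hlo.trans_le he.1
    have habs : |e| ≤ c₀ * η / 2 := by rw [abs_of_pos he0]; exact heθ
    have h := integral_inv_envelope_le_cooper hab (hG e he) hη hc₀ hc₁ hL₁ (hL e he) (hdich e he) hN habs (hte e he)
    have hte' := hte e he
    have hlog : log⁺ (c₀ * η / (4 * t e)) ≤ log⁺ (c₀ * η / 2 / (2 * e)) := by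
      refine Real.posLog_le_posLog (div_nonneg (by positivity) (by linarith)) ?_
      rw [div_div]
      exact div_le_div_of_nonneg_left (by positivity) (by positivity) (by nlinarith [ht e he])
    refine h.trans ?_
    have e1 : (4 * (b - a) / c₀ + N * (2 / c₁) * log⁺ (c₀ * η / (4 * t e))) / η =
        4 * (b - a) / c₀ / η + N * (2 / c₁) / η * log⁺ (c₀ * η / (4 * t e)) := by ring
    rw [e1]
    have hR : 0 ≤ (N : ℝ) * (2 / c₁) / η := by positivity
    linarith [mul_le_mul_of_nonneg_left hlog hR]
  · -- large levels: the trivial bound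
    intro e he _
    have he0 : 0 < e := hlo.trans_le he.1
    exact (integral_inv_envelope_le_trivial hab (G e) (hte e he)).trans (div_le_div_of_nonneg_left (by linarith) he0 (ht e he))

end Assembled

/-! ## §7 The COOPER WINDOW layer: one logarithm of the distance to the Cooper configuration is integrable in the tube angle -/

section Window

/-- Pointwise majorant on the right half-window: for `c < ϑ ≤ c + δ`, `log⁺(M/|ϑ − c|) ≤ log⁺(M/δ) + (log δ − log(ϑ − c))`. -/
theorem posLog_div_abs_sub_le_right {M c δ ϑ : ℝ} (h1 : c < ϑ) (h2 : ϑ ≤ c + δ) :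
    log⁺ (M / |ϑ - c|) ≤ log⁺ (M / δ) + (Real.log δ - Real.log (ϑ - c)) := by
  have hx : 0 < ϑ - c := sub_pos.2 h1
  have hxδ : ϑ - c ≤ δ := by linarith
  have hδ : 0 < δ := hx.trans_le hxδ
  rw [abs_of_pos hx, ← Real.log_div hδ.ne' hx.ne']
  exact posLog_div_le_posLog_div_add_log hx hxδ

/-- **THE COOPER WINDOW LAYER.**  `F ≥ 0` on `[c − δ, c + δ]` with `F ϑ ≤ K + P·log⁺(M/|ϑ − c|)` off the centre (`K, P ≥ 0`, `δ > 0`) ⟹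
`∫_{c−δ..c+δ} F ≤ 2δ·(K + P·(1 + log⁺(M/δ)))`.  With `c = π` (or the Cooper tube angle), `K = W·(2(b−a) + 2Nĉ₀/ĉ₁)`, `P = W·(b − a)`, `M = 2hi/ĉ₀` this closes
the Cooper class of `level_loop_inv_envelope_le_cooper`: the tube-angle integral of the absolute bubble over the Cooper window is `n`-free.
(No integrability hypothesis on `F`.) [cite: Salmhofer1999, §4.5.3 Cor. 4.11] -/
theorem intervalIntegral_cooper_window_le {F : ℝ → ℝ} {c δ K P M : ℝ} (hδ : 0 < δ) (hK : 0 ≤ K) (hP : 0 ≤ P)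
    (hF0 : ∀ ϑ ∈ Icc (c - δ) (c + δ), 0 ≤ F ϑ) (hF : ∀ ϑ ∈ Icc (c - δ) (c + δ), ϑ ≠ c → F ϑ ≤ K + P * log⁺ (M / |ϑ - c|)) :
    ∫ ϑ in (c - δ)..(c + δ), F ϑ ≤ 2 * δ * (K + P * (1 + log⁺ (M / δ))) := by
  have hRHS1 : 0 ≤ δ * (K + P * (1 + log⁺ (M / δ))) := by
    have := Real.posLog_nonneg (x := M / δ); positivity
  by_cases hint : IntervalIntegrable F volume (c - δ) (c + δ)
  swap
  · rw [intervalIntegral.integral_undef hint]; linarith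
  have hi1 : IntervalIntegrable F volume (c - δ) c :=
    hint.mono_set (by rw [uIcc_of_le (by linarith), uIcc_of_le (by linarith)]; exact Icc_subset_Icc le_rfl (by linarith))
  have hi2 : IntervalIntegrable F volume c (c + δ) :=
    hint.mono_set (by rw [uIcc_of_le (by linarith), uIcc_of_le (by linarith)]; exact Icc_subset_Icc (by linarith) le_rfl)
  rw [← intervalIntegral.integral_add_adjacent_intervals hi1 hi2]
  -- the value of the logarithmic majorant on a half-window
  have hlogint : ∫ x in (0:ℝ)..δ, Real.log x = δ * Real.log δ - δ := by rw [integral_log]; simp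
  -- right half `[c, c + δ]`
  have hright : ∫ ϑ in c..(c + δ), F ϑ ≤ δ * (K + P * (1 + log⁺ (M / δ))) := by
    set m : ℝ → ℝ := fun ϑ => K + P * (log⁺ (M / δ) + (Real.log δ - Real.log (ϑ - c))) with hm
    have hlogi : IntervalIntegrable (fun ϑ => Real.log (ϑ - c)) volume c (c + δ) := by
      have h := (intervalIntegral.intervalIntegrable_log' (a := 0) (b := δ)).comp_sub_right c
      simp only [zero_add] at h
      rwa [add_comm] at h
    have hmi : IntervalIntegrable m volume c (c + δ) :=
      intervalIntegrable_const.add ((intervalIntegrable_const.add (intervalIntegrable_const.sub hlogi)).const_mul P)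
    have hle : ∫ ϑ in c..(c + δ), F ϑ ≤ ∫ ϑ in c..(c + δ), m ϑ := by
      rw [intervalIntegral.integral_of_le (by linarith), intervalIntegral.integral_of_le (by linarith)]
      refine integral_mono_of_nonneg ?_ hmi.1 ?_
      · exact (ae_restrict_iff' measurableSet_Ioc).2 (Eventually.of_forall fun ϑ hϑ => hF0 ϑ ⟨by linarith [hϑ.1], hϑ.2⟩)
      · refine (ae_restrict_iff' measurableSet_Ioc).2 (Eventually.of_forall fun ϑ hϑ => ?_)
        have h := hF ϑ ⟨by linarith [hϑ.1], hϑ.2⟩ (ne_of_gt hϑ.1)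
        have h' := posLog_div_abs_sub_le_right (M := M) hϑ.1 hϑ.2
        have h'' := mul_le_mul_of_nonneg_left h' hP
        show F ϑ ≤ K + P * (log⁺ (M / δ) + (Real.log δ - Real.log (ϑ - c)))
        linarith
    refine hle.trans (le_of_eq ?_)
    rw [hm, intervalIntegral.integral_add intervalIntegrable_const ((intervalIntegrable_const.add (intervalIntegrable_const.sub hlogi)).const_mul P),
      intervalIntegral.integral_const_mul, intervalIntegral.integral_add intervalIntegrable_const (intervalIntegrable_const.sub hlogi),
      intervalIntegral.integral_sub intervalIntegrable_const hlogi, intervalIntegral.integral_const, intervalIntegral.integral_const,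
      intervalIntegral.integral_const, intervalIntegral.integral_comp_sub_right (fun x => Real.log x) c]
    simp only [sub_self, add_sub_cancel_left, smul_eq_mul]
    rw [hlogint]; ring
  -- left half `[c − δ, c]`
  have hleft : ∫ ϑ in (c - δ)..c, F ϑ ≤ δ * (K + P * (1 + log⁺ (M / δ))) := by
    set m : ℝ → ℝ := fun ϑ => K + P * (log⁺ (M / δ) + (Real.log δ - Real.log (c - ϑ))) with hm
    have hlogi : IntervalIntegrable (fun ϑ => Real.log (c - ϑ)) volume (c - δ) c := by
      have h := (intervalIntegral.intervalIntegrable_log' (a := δ) (b := 0)).comp_sub_left c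
      simpa using h
    have hmi : IntervalIntegrable m volume (c - δ) c :=
      intervalIntegrable_const.add ((intervalIntegrable_const.add (intervalIntegrable_const.sub hlogi)).const_mul P)
    have hle : ∫ ϑ in (c - δ)..c, F ϑ ≤ ∫ ϑ in (c - δ)..c, m ϑ := by
      -- compare on the OPEN half-window (the centre is a null set; `hF` is not available at `ϑ = c`)
      rw [intervalIntegral.integral_of_le (by linarith), intervalIntegral.integral_of_le (by linarith), integral_Ioc_eq_integral_Ioo,
        integral_Ioc_eq_integral_Ioo]
      refine integral_mono_of_nonneg ?_ (hmi.1.mono_set Ioo_subset_Ioc_self) ?_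
      · exact (ae_restrict_iff' measurableSet_Ioo).2 (Eventually.of_forall fun ϑ hϑ => hF0 ϑ ⟨hϑ.1.le, by linarith [hϑ.2]⟩)
      · refine (ae_restrict_iff' measurableSet_Ioo).2 (Eventually.of_forall fun ϑ hϑ => ?_)
        have h := hF ϑ ⟨hϑ.1.le, by linarith [hϑ.2]⟩ (ne_of_lt hϑ.2)
        have h' : log⁺ (M / |ϑ - c|) ≤ log⁺ (M / δ) + (Real.log δ - Real.log (c - ϑ)) := by
          have hx : 0 < c - ϑ := sub_pos.2 hϑ.2
          have hxδ : c - ϑ ≤ δ := by linarith [hϑ.1]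
          rw [abs_sub_comm, abs_of_pos hx, ← Real.log_div hδ.ne' hx.ne']
          exact posLog_div_le_posLog_div_add_log hx hxδ
        have h'' := mul_le_mul_of_nonneg_left h' hP
        show F ϑ ≤ K + P * (log⁺ (M / δ) + (Real.log δ - Real.log (c - ϑ)))
        linarith
    refine hle.trans (le_of_eq ?_)
    rw [hm, intervalIntegral.integral_add intervalIntegrable_const ((intervalIntegrable_const.add (intervalIntegrable_const.sub hlogi)).const_mul P),
      intervalIntegral.integral_const_mul, intervalIntegral.integral_add intervalIntegrable_const (intervalIntegrable_const.sub hlogi),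
      intervalIntegral.integral_sub intervalIntegrable_const hlogi, intervalIntegral.integral_const, intervalIntegral.integral_const,
      intervalIntegral.integral_const, intervalIntegral.integral_comp_sub_left (fun x => Real.log x) c]
    simp only [sub_sub_cancel, sub_self, smul_eq_mul]
    rw [hlogint]; ring
  linarith

end Window

end Summit.HubbardSuperconductivity.HubbardSuperconductivity.Theorems.C4a

end
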